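import Mathlib
import Summits.CriticalPhenomena.CardyFormulaZ2.Theorems.CardySelfRefinementGradientComparabilityStubDcZeroHalfGeSumPivotal
import Summits.CriticalPhenomena.CardyFormulaZ2.Theorems.CardySelfRefinementGradientComparabilityStubRussoWithinSigned
import HarnessLib

/-!
# Russo dictionary in the `c`-direction: `∂cP(ρ,c) = Σ_{non-axial e ∈ window} M_k(ρ,c)(e pivotal)`

Crux `stmt-CriticalPhenomena-10269`
(`Summit.CriticalPhenomena.CardyFormulaZ2.Theses.CardySelfRefinement.GradientComparability`),
line **Sketch**, stub `stub_Dc_eq_sum_pivotal` (infrastructure stub: the general Russo dictionary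
in the `c`-direction, generalising the landed endpoint inequality
`stub_Dc_zero_half_ge_sum_pivotal`).  Vocabulary (`ax tb opn cfg prm M P Dc window Aloc edgeOf
coinsOf coinWindow …`) from `CardySelfRefinementDefs`.

## Mathematics

Russo's formula in the `c`-direction for the self-refinement model
`M_k(ρ,c) = (prodBernoulli (prm k ρ c)).map (cfg k)` (Grimmett 1999, Thm. 2.25 / Russo 1981, §4,
Lemma 3, in the signed multi-parameter form `stub_russoWithin_signed`, within `[0,1]`).
For `η ≠ 0` the crossing probability is the coin probability of the pulled-back cylinder
`E = cfg k ⁻¹' Aloc m F η`, determined by the finite coin window.  Along `b ↦ prm k ρ b` the only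
coins whose bias depends on `b` are the OWN coins `(v,d,0)` of the NON-axial edges `(v,d)`, with
bias `projIcc 0 1 b = b` on `[0,1]` (derivative `1` within `[0,1]`); every other bias is constant.
Hence `∂cP(ρ,c) = Σ_{own coins i of non-axial window edges} (P(E | i on) − P(E | i off))`.
The own coin `(v,d,0)` is read by its own edge only, and for a non-axial edge the read-out is the
own coin itself, so `cfg k (insert i S) = insert e (cfg k S)` and `cfg k (S \ {i}) = cfg k S \ {e}`
with `e = edgeOf (v,d)`; pushing forward, the two conditional probabilities are
`M_k(ρ,c){ω | insert e ω ∈ Aloc}` and `M_k(ρ,c){ω | ω \ {e} ∈ Aloc}`, whose difference is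
`M_k(ρ,c)(e pivotal for Aloc)` because `Aloc` is increasing.  Finally the own coins of the
non-axial window edges are in bijection with those edges (`edgeOf` is injective).
-/

noncomputable section

namespace Summit.CriticalPhenomena.CardyFormulaZ2.Theorems.CardySelfRefinement

open scoped Topology
open Filter Set MeasureTheory
open Literature.Probability.LatticeModels Literature.Probability.Percolation
open Literature.Probability.Percolation.QuadCrossing
open Summit.CriticalPhenomena.CardyFormulaZ2.Theses.CardySelfRefinement

/-! ## The own coin of a non-axial edge is read by that edge only -/

/-- The own coin `(v,d,0)` is among the coins read by the edge `vd` iff `vd = (v,d)` (the shared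
and selector coins have third component `1`, `2`). -/
theorem own_mem_coinsOf_iff (k : ℕ) (vd : Site 2 × Fin 2) (v : Site 2) (d : Fin 2) :
    (v, d, (0 : Fin 3)) ∈ coinsOf k vd ↔ vd = (v, d) := by
  obtain ⟨v', d'⟩ := vd
  simp only [coinsOf, Set.mem_insert_iff, Set.mem_singleton_iff, Prod.mk.injEq]
  constructor
  · rintro (⟨rfl, rfl, -⟩ | ⟨-, -, h⟩ | ⟨-, -, h⟩)
    · exact ⟨rfl, rfl⟩
    · exact absurd h (by decide)
    · exact absurd h (by decide)
  · rintro ⟨rfl, rfl⟩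
    exact Or.inl ⟨rfl, rfl, trivial⟩

/-- An own coin `(v,d,0)` lies in the coin window of `W` iff its edge `edgeOf (v,d)` lies in `W`. -/
theorem own_mem_coinWindow_iff (k : ℕ) (W : Set (Sym2 (Site 2))) (v : Site 2) (d : Fin 2) :
    (v, d, (0 : Fin 3)) ∈ coinWindow k W ↔ edgeOf (v, d) ∈ W := by
  constructor
  · intro h
    rw [coinWindow, Set.mem_iUnion₂] at h
    obtain ⟨vd, hvd, hi⟩ := h
    rw [(own_mem_coinsOf_iff k vd v d).1 hi] at hvd
    exact hvd
  · exact own_mem_coinWindow k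

/-- Coin sets agreeing off the own coin `(v,d,0)` give the same read-out of every edge other than
`(v,d)`. -/
theorem opn_congr_of_ne_own (k : ℕ) {S S' : Set (Site 2 × Fin 2 × Fin 3)} {v : Site 2} {d : Fin 2}
    (h : ∀ i, i ≠ (v, d, (0 : Fin 3)) → (i ∈ S ↔ i ∈ S')) {vd : Site 2 × Fin 2}
    (hvd : vd ≠ (v, d)) : opn k S vd ↔ opn k S' vd :=
  opn_congr k vd fun i hi => h i fun hi0 => hvd ((own_mem_coinsOf_iff k vd v d).1 (hi0 ▸ hi))

/-- For a NON-axial edge `(v,d)`, switching its own coin on switches exactly the edge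
`edgeOf (v,d)` on. -/
theorem cfg_insert_own (k : ℕ) (S : Set (Site 2 × Fin 2 × Fin 3)) {v : Site 2} {d : Fin 2}
    (hax : ¬ ax k (v, d)) :
    cfg k (insert (v, d, (0 : Fin 3)) S) = insert (edgeOf (v, d)) (cfg k S) := by
  have hoff : ∀ vd : Site 2 × Fin 2, vd ≠ (v, d) →
      (opn k (insert (v, d, (0 : Fin 3)) S) vd ↔ opn k S vd) := fun vd hvd =>
    opn_congr_of_ne_own k (fun i hi => by simp only [Set.mem_insert_iff, hi, false_or]) hvd
  have hon : opn k (insert (v, d, (0 : Fin 3)) S) (v, d) := by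
    simp only [opn, if_neg hax]
    exact Set.mem_insert _ _
  ext e
  constructor
  · rintro ⟨v', d', rfl, hopn⟩
    by_cases hvd : (v', d') = (v, d)
    · rw [Prod.mk.injEq] at hvd
      obtain ⟨rfl, rfl⟩ := hvd
      exact Set.mem_insert _ _
    · exact Set.mem_insert_of_mem _ ⟨v', d', rfl, (hoff (v', d') hvd).1 hopn⟩
  · rintro (rfl | ⟨v', d', rfl, hopn⟩)
    · exact ⟨v, d, rfl, hon⟩
    · by_cases hvd : (v', d') = (v, d)
      · rw [Prod.mk.injEq] at hvd
        obtain ⟨rfl, rfl⟩ := hvd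
        exact ⟨_, _, rfl, hon⟩
      · exact ⟨v', d', rfl, (hoff (v', d') hvd).2 hopn⟩

/-- For a NON-axial edge `(v,d)`, switching its own coin off switches exactly the edge
`edgeOf (v,d)` off. -/
theorem cfg_sdiff_own (k : ℕ) (S : Set (Site 2 × Fin 2 × Fin 3)) {v : Site 2} {d : Fin 2}
    (hax : ¬ ax k (v, d)) :
    cfg k (S \ {(v, d, (0 : Fin 3))}) = cfg k S \ {edgeOf (v, d)} := by
  have hoff : ∀ vd : Site 2 × Fin 2, vd ≠ (v, d) →
      (opn k (S \ {(v, d, (0 : Fin 3))}) vd ↔ opn k S vd) := fun vd hvd =>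
    opn_congr_of_ne_own k
      (fun i hi => by simp only [Set.mem_sdiff, Set.mem_singleton_iff, hi, not_false_eq_true, and_true])
      hvd
  have hoff' : ¬ opn k (S \ {(v, d, (0 : Fin 3))}) (v, d) := by
    simp only [opn, if_neg hax, Set.mem_sdiff, Set.mem_singleton_iff, not_true_eq_false, and_false,
      not_false_eq_true]
  ext e
  constructor
  · rintro ⟨v', d', rfl, hopn⟩
    have hvd : (v', d') ≠ (v, d) := by
      intro h
      rw [Prod.mk.injEq] at h
      obtain ⟨rfl, rfl⟩ := h
      exact hoff' hopn
    exact ⟨⟨v', d', rfl, (hoff _ hvd).1 hopn⟩,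
      fun h => hvd (edgeOf_injective (a₁ := (v', d')) (a₂ := (v, d)) h)⟩
  · rintro ⟨⟨v', d', rfl, hopn⟩, hne⟩
    have hvd : (v', d') ≠ (v, d) := by
      intro h
      rw [Prod.mk.injEq] at h
      obtain ⟨rfl, rfl⟩ := h
      exact hne rfl
    exact ⟨v', d', rfl, (hoff _ hvd).2 hopn⟩

/-! ## Pivotality of an edge for an increasing event, as a difference of probabilities -/

/-- Opening a fixed coordinate is a measurable self-map of `Set α`. -/
theorem measurable_insert_pt {α : Type*} (e : α) : Measurable fun ω : Set α => insert e ω :=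
  measurable_set_iff.2 fun a => show Measurable fun ω : Set α => a = e ∨ a ∈ ω from
    measurable_const.or (measurable_set_mem a)

/-- Closing a fixed coordinate is a measurable self-map of `Set α`. -/
theorem measurable_sdiff_pt {α : Type*} (e : α) : Measurable fun ω : Set α => ω \ {e} :=
  measurable_set_iff.2 fun a => show Measurable fun ω : Set α => a ∈ ω ∧ ¬ a = e from
    (measurable_set_mem a).and measurable_const

/-- For an increasing measurable event `B` and a finite measure `ν` on `Set α`:
`ν{ω | insert e ω ∈ B} − ν{ω | ω \ {e} ∈ B} = ν{ω | e pivotal for B in ω}` (for increasing `B`,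
`{ω \ {e} ∈ B} ⊆ {insert e ω ∈ B}` and the pivotality event is their difference; Russo 1981, §4,
proof of Lemma 3). -/
theorem measureReal_insert_sub_sdiff {α : Type*} {B : Set (Set α)} (hB : IsUpperSet B)
    (hBm : MeasurableSet B) (ν : Measure (Set α)) [IsFiniteMeasure ν] (e : α) :
    ν.real {ω | insert e ω ∈ B} - ν.real {ω | ω \ {e} ∈ B} = ν.real {ω | IsPivotal B e ω} := by
  have hsub : {ω : Set α | ω \ {e} ∈ B} ⊆ {ω | insert e ω ∈ B} := fun ω hω =>
    hB (Set.sdiff_subset.trans (Set.subset_insert e ω)) hω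
  have hpiv : {ω : Set α | IsPivotal B e ω} = {ω | insert e ω ∈ B} \ {ω | ω \ {e} ∈ B} := by
    ext ω
    constructor
    · rintro (⟨h1, h2⟩ | ⟨h1, h2⟩)
      · exact ⟨h1, h2⟩
      · exact absurd (hsub h1) h2
    · rintro ⟨h1, h2⟩
      exact Or.inl ⟨h1, h2⟩
  rw [hpiv, measureReal_sdiff hsub (measurable_sdiff_pt e hBm)]

/-! ## The model-specific dictionary entries -/

/-- Along `b ↦ prm k ρ b` (the `c`-direction) the own coin of a non-axial edge has bias
`projIcc 0 1 b = b` on `[0,1]`, hence derivative `1` within `[0,1]` at `c ∈ [0,1]`; every other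
bias is constant in `b` (derivative `0`). -/
theorem hasDerivWithinAt_prm_c (k : ℕ) (ρ : ℝ) (i : Site 2 × Fin 2 × Fin 3) {c : ℝ}
    (hc : c ∈ Set.Icc (0 : ℝ) 1) :
    HasDerivWithinAt (fun b : ℝ => (prm k ρ b i : ℝ))
      (if i.2.2 = 0 ∧ ¬ ax k (i.1, i.2.1) then (1 : ℝ) else 0) (Set.Icc 0 1) c := by
  by_cases h : i.2.2 = 0 ∧ ¬ ax k (i.1, i.2.1)
  · rw [if_pos h]
    have hid : HasDerivWithinAt (fun b : ℝ => b) 1 (Set.Icc 0 1) c := hasDerivWithinAt_id c _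
    refine hid.congr_of_mem (fun b hb => ?_) hc
    simp only [prm, if_pos h.1, if_neg h.2, Set.projIcc_of_mem _ hb]
  · rw [if_neg h]
    have hf : (fun b : ℝ => (prm k ρ b i : ℝ)) = fun _ => (prm k ρ 0 i : ℝ) := by
      funext b
      simp only [prm]
      split_ifs with h0 hax
      · rfl
      · exact absurd ⟨h0, hax⟩ h
      · rfl
      · rfl
    rw [hf]
    exact hasDerivWithinAt_const _ _ _

/-- The coin-side Russo term of the own coin `(v,d,0)` of a non-axial edge is the
`M_k(ρ,c)`-probability that `edgeOf (v,d)` is pivotal for `Aloc`. -/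
theorem real_insert_sub_sdiff_own (k m : ℕ) (F : Fin m → Quad (Set.univ : Set ℂ)) {η : ℝ}
    (hη : η ≠ 0) (ρ c : ℝ) {v : Site 2} {d : Fin 2} (hax : ¬ ax k (v, d)) :
    (prodBernoulli (prm k ρ c)).real
        {S | insert (v, d, (0 : Fin 3)) S ∈ (cfg k) ⁻¹' Aloc m F η} -
      (prodBernoulli (prm k ρ c)).real
        {S | S \ {(v, d, (0 : Fin 3))} ∈ (cfg k) ⁻¹' Aloc m F η} =
      (M k ρ c).real {ω | IsPivotal (Aloc m F η) (edgeOf (v, d)) ω} := by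
  haveI := isProbabilityMeasure_M k ρ c
  have h1 : {S : Set (Site 2 × Fin 2 × Fin 3) | insert (v, d, (0 : Fin 3)) S ∈ (cfg k) ⁻¹' Aloc m F η}
      = (cfg k) ⁻¹' {ω | insert (edgeOf (v, d)) ω ∈ Aloc m F η} := by
    ext S
    simp only [Set.mem_setOf_eq, Set.mem_preimage, cfg_insert_own k S hax]
  have h2 : {S : Set (Site 2 × Fin 2 × Fin 3) | S \ {(v, d, (0 : Fin 3))} ∈ (cfg k) ⁻¹' Aloc m F η}
      = (cfg k) ⁻¹' {ω | ω \ {edgeOf (v, d)} ∈ Aloc m F η} := by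
    ext S
    simp only [Set.mem_setOf_eq, Set.mem_preimage, cfg_sdiff_own k S hax]
  have hm1 : MeasurableSet {ω : Set (Sym2 (Site 2)) | insert (edgeOf (v, d)) ω ∈ Aloc m F η} :=
    measurable_insert_pt _ (measurableSet_Aloc m F hη)
  have hm2 : MeasurableSet {ω : Set (Sym2 (Site 2)) | ω \ {edgeOf (v, d)} ∈ Aloc m F η} :=
    measurable_sdiff_pt _ (measurableSet_Aloc m F hη)
  rw [h1, h2, ← map_measureReal_apply (measurable_cfg k) hm1,
    ← map_measureReal_apply (measurable_cfg k) hm2]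
  exact measureReal_insert_sub_sdiff (isUpperSet_Aloc m F η) (measurableSet_Aloc m F hη) (M k ρ c)
    (edgeOf (v, d))

/-! ## The stub -/

/-- **RUSSO DICTIONARY, `c`-direction.**  For `η ≠ 0`, `c ∈ [0,1]` and any `ρ`: the coins with
`c`-dependent bias are exactly the own coins of the NON-axial edges, each read by its own edge
only (`cfg k (insert i S) = insert e (cfg k S)`), and `projIcc` has derivative `1` within `[0,1]`;
so by Russo's formula (signed form, within `[0,1]`)
`∂cP(ρ,c) = Σ_{non-axial e ∈ window} M_k(ρ,c)(e pivotal for Aloc)`, `W` being the set of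
non-axial window edges (given by a membership characterisation). -/
theorem stub_Dc_eq_sum_pivotal (k m : ℕ) (F : Fin m → Quad (Set.univ : Set ℂ)) {η : ℝ} (hη : η ≠ 0)
    (ρ : ℝ) {c : ℝ} (hc : c ∈ Set.Icc (0 : ℝ) 1) (W : Finset (Sym2 (Site 2)))
    (hW : ∀ e, e ∈ W ↔ e ∈ window m F η ∧ ∃ (v : Site 2) (d : Fin 2), e = edgeOf (v, d) ∧ ¬ ax k (v, d)) :
    Dc k m F η (ρ, c) = ∑ e ∈ W, (M k ρ c).real {ω | IsPivotal (Aloc m F η) e ω} := by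
  classical
  obtain ⟨K, hK⟩ := exists_coinFinset k m F hη
  -- the coin-side event and its finite support
  have hdet : DeterminedBy ((cfg k) ⁻¹' Aloc m F η) (↑K : Set (Site 2 × Fin 2 × Fin 3)) :=
    hK ▸ determinedBy_preimage_Aloc k m F η
  -- `P(ρ, ·)` on the coin side
  have hfun : (fun c' => P k m F η ρ c') =
      fun c' => (prodBernoulli (prm k ρ c')).real ((cfg k) ⁻¹' Aloc m F η) := by
    funext c'
    rw [P_eq_real_Aloc, map_measureReal_apply (measurable_cfg k) (measurableSet_Aloc m F hη)]
  -- Russo's formula (signed, within `[0,1]`) along `b ↦ prm k ρ b`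
  have hderiv := stub_russoWithin_signed (fun b => prm k ρ b) ((cfg k) ⁻¹' Aloc m F η) hdet
    (Set.Icc 0 1) c (fun i => if i.2.2 = 0 ∧ ¬ ax k (i.1, i.2.1) then (1 : ℝ) else 0)
    (fun i _ => hasDerivWithinAt_prm_c k ρ i hc)
  -- `Dc` is that derivative (unique derivatives within `[0,1]`)
  have hD : Dc k m F η (ρ, c) = ∑ i ∈ K,
      (if i.2.2 = 0 ∧ ¬ ax k (i.1, i.2.1) then (1 : ℝ) else 0) *
        ((prodBernoulli (prm k ρ c)).real {S | insert i S ∈ (cfg k) ⁻¹' Aloc m F η} -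
          (prodBernoulli (prm k ρ c)).real {S | S \ {i} ∈ (cfg k) ⁻¹' Aloc m F η}) := by
    show derivWithin (fun c' => P k m F η ρ c') (Set.Icc 0 1) c = _
    rw [hfun]
    exact hderiv.derivWithin (uniqueDiffOn_Icc zero_lt_one c hc)
  rw [hD]
  simp only [ite_mul, one_mul, zero_mul]
  rw [← Finset.sum_filter]
  -- reindex the own coins of the non-axial window edges by their edges (`edgeOf` is injective)
  refine Finset.sum_bij (fun i _ => edgeOf (i.1, i.2.1)) ?_ ?_ ?_ ?_
  · rintro ⟨v, d, j⟩ hi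
    simp only [Finset.mem_filter] at hi
    obtain ⟨hiK, rfl, hax⟩ := hi
    rw [hW]
    refine ⟨?_, v, d, rfl, hax⟩
    have hi' : ((v, d, (0 : Fin 3)) : Site 2 × Fin 2 × Fin 3) ∈ coinWindow k (window m F η) := by
      rw [← hK]
      exact Finset.mem_coe.2 hiK
    exact (own_mem_coinWindow_iff k _ v d).1 hi'
  · rintro ⟨v₁, d₁, j₁⟩ h₁ ⟨v₂, d₂, j₂⟩ h₂ h
    simp only [Finset.mem_filter] at h₁ h₂
    have h12 := edgeOf_injective h
    simp only [Prod.mk.injEq] at h12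
    obtain ⟨rfl, rfl⟩ := h12
    rw [h₁.2.1, h₂.2.1]
  · intro e he
    obtain ⟨hew, v, d, rfl, hax⟩ := (hW e).1 he
    refine ⟨(v, d, (0 : Fin 3)), Finset.mem_filter.2 ⟨?_, rfl, hax⟩, rfl⟩
    rw [← Finset.mem_coe, hK]
    exact own_mem_coinWindow k hew
  · rintro ⟨v, d, j⟩ hi
    simp only [Finset.mem_filter] at hi
    obtain ⟨-, rfl, hax⟩ := hi
    exact real_insert_sub_sdiff_own k m F hη ρ c hax

end Summit.CriticalPhenomena.CardyFormulaZ2.Theorems.CardySelfRefinement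

end
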